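import Mathlib.AlgebraicGeometry.EllipticCurve.VariableChange
import Mathlib.Topology.Instances.Real.Lemmas
import Mathlib.Order.Filter.AtTopBot.Basic
import Mathlib.Algebra.Order.BigOperators.Ring.Finset
import HarnessLib

-- provenance: harness21/H21/H21/Prelude/TranscendEllArithS/HeightFamily.lean @ efa73f9 (interim HEAD d8f2665); M5 mechanical rewrite
/-!
# The family of all elliptic curves over `ℚ` ordered by naive height

Trunk `TranscendEllArithS`, prelude item C21 (notion `family_height_ordering`).

Every elliptic curve `E/ℚ` has a unique model `E_{A,B} : y² = x³ + Ax + B` with `A, B ∈ ℤ`,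
`4A³ + 27B² ≠ 0`, and no prime `p` with `p⁴ ∣ A`, `p⁶ ∣ B`. Ordering these pairs by the naive
height `H(E_{A,B}) = max (4|A|³, 27B²)` gives the family in which Bhargava–Shankar compute
average Selmer sizes and bound the average rank.

Sources: M. Bhargava, A. Shankar, *Binary quartic forms having bounded invariants, and the
boundedness of the average rank of elliptic curves*, Ann. of Math. 181 (2015), §1;
M. Bhargava, C. Skinner, W. Zhang, *A majority of elliptic curves over `ℚ` satisfy the Birch
and Swinnerton-Dyer conjecture*, arXiv:1407.1826 (2014).

## Design choices

* **Wave0 compatibility.** The five definitions `shortWeierstrass`, `IsInHeightFamily`,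
  `naiveHeight`, `heightFamilyBelow`, `heightAverage` are *verbatim* copies (same names, types
  and bodies) of the accepted `H21/Statements/BSD/Wave0.lean` (namespace `Literature.BSD`,
  lines 182–205). A Prelude file cannot import a Statements file; the supervisor will later
  delete the Wave0 copies in favour of these (namespace `Literature`).
* Densities and averages are phrased as `∀ ε > 0, ∀ᶠ X in atTop, …` (Wave0 rule), never via
  `Filter.limsup`/`Filter.liminf` of real sequences (junk values on unbounded sequences).
  In particular Wave0's `AverageRankLE c` is definitionally
  `HeightAverageLE (fun AB ↦ (mordellWeilRank (shortWeierstrass AB) : ℝ)) c`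
  (`mordellWeilRank` lives in the C10 prelude file and is not imported here).
* `heightAverage f X` has junk value `0` when no curve has height `< X` (division by the
  cardinality `0`), hence so does `heightProportion`.
* Mathlib has `WeierstrassCurve`, `WeierstrassCurve.IsElliptic`, `WeierstrassCurve.VariableChange`
  (with its `MulAction` on curves), all used here; it has no height-ordered family of curves.
-/

namespace Literature.NumberTheory.EllipticCurves

open scoped Classical
open Filter WeierstrassCurve Topology

/-! ### Verbatim Wave0 definitions -/

/-- The short Weierstrass curve `E_{A,B} : y² = x³ + Ax + B` over `ℚ` with integer coefficients
(Bhargava–Shankar, Ann. of Math. 181 (2015) §1). [folklore] -/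
def shortWeierstrass (AB : ℤ × ℤ) : WeierstrassCurve ℚ :=
  ⟨0, 0, 0, AB.1, AB.2⟩

/-- Membership in the Bhargava–Shankar family: `(A, B) ∈ ℤ²` with `4A³ + 27B² ≠ 0` (so that
`E_{A,B}` is an elliptic curve) and no prime `p` with `p⁴ ∣ A` and `p⁶ ∣ B` (each `ℚ`-isomorphism
class is represented exactly once) (Bhargava–Shankar, Ann. of Math. 181 (2015) §1). [folklore] -/
def IsInHeightFamily (AB : ℤ × ℤ) : Prop :=
  4 * AB.1 ^ 3 + 27 * AB.2 ^ 2 ≠ 0 ∧ ∀ p : ℕ, p.Prime → ¬((p : ℤ) ^ 4 ∣ AB.1 ∧ (p : ℤ) ^ 6 ∣ AB.2)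

/-- The naive height `H(E_{A,B}) = max (4|A|³) (27 B²)` (Bhargava–Shankar, Ann. of Math. 181
(2015) §1). [folklore] -/
def naiveHeight (AB : ℤ × ℤ) : ℤ :=
  max (4 * |AB.1| ^ 3) (27 * AB.2 ^ 2)

/-- The finite set of curves `E_{A,B}` in the family with naive height `< X`. Since
`4|A|³ < X` and `27B² < X` force `|A|, |B| ≤ X`, filtering the box `[-X, X]²` loses nothing
(Bhargava–Shankar, Ann. of Math. 181 (2015) §1). [folklore] -/
noncomputable def heightFamilyBelow (X : ℕ) : Finset (ℤ × ℤ) :=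
  (Finset.Icc (-(X : ℤ)) X ×ˢ Finset.Icc (-(X : ℤ)) X).filter
    fun AB ↦ IsInHeightFamily AB ∧ naiveHeight AB < X

/-- The average of a real-valued invariant `f` over the curves of naive height `< X`
(junk value `0` when the set is empty, i.e. for small `X`) (Bhargava–Shankar 2015 §1). [cite: BhargavaShankar2015, §1] -/
noncomputable def heightAverage (f : ℤ × ℤ → ℝ) (X : ℕ) : ℝ :=
  (∑ AB ∈ heightFamilyBelow X, f AB) / (heightFamilyBelow X).card

/-! ### New definitions: proportions and densities -/

/-- The proportion of curves of naive height `< X` satisfying the property `P`, i.e. the height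
average of the indicator of `P` (junk value `0` for small `X`)
(Bhargava–Skinner–Zhang 2014, §1). [cite: BhargavaSkinnerZhang2014, §1] -/
noncomputable def heightProportion (P : ℤ × ℤ → Prop) (X : ℕ) : ℝ :=
  heightAverage (fun AB ↦ if P AB then 1 else 0) X

/-- `HeightAverageLE f c`: the average of `f` over curves of naive height `< X` is eventually at
most `c + ε` for every `ε > 0`, i.e. `limsup_{X → ∞} Avg_{H < X} f ≤ c`, phrased without
`Filter.limsup`. Wave0's `AverageRankLE c` is by definition
`HeightAverageLE (fun AB ↦ (mordellWeilRank (shortWeierstrass AB) : ℝ)) c`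
(Bhargava–Shankar, Ann. of Math. 181 (2015) Thm 1.2). [folklore] -/
def HeightAverageLE (f : ℤ × ℤ → ℝ) (c : ℝ) : Prop :=
  ∀ ε : ℝ, 0 < ε → ∀ᶠ X : ℕ in atTop, heightAverage f X ≤ c + ε

/-- `HeightDensityGE P δ`: at least a proportion `δ` of elliptic curves over `ℚ`, ordered by
naive height, satisfy `P`, i.e. `liminf_{X → ∞}` of the proportion is `≥ δ`, phrased without
`Filter.liminf` (Bhargava–Shankar 2015 Thm 1.4; Bhargava–Skinner–Zhang 2014 Thm 1). [cite: BhargavaShankar2015, Thm 1.4] -/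
def HeightDensityGE (P : ℤ × ℤ → Prop) (δ : ℝ) : Prop :=
  ∀ ε : ℝ, 0 < ε → ∀ᶠ X : ℕ in atTop, δ - ε ≤ heightProportion P X

/-- `HasHeightDensity P δ`: the proportion of elliptic curves over `ℚ` of naive height `< X`
satisfying `P` tends to `δ` as `X → ∞` (Bhargava–Skinner–Zhang 2014, §1). [cite: BhargavaSkinnerZhang2014, §1] -/
def HasHeightDensity (P : ℤ × ℤ → Prop) (δ : ℝ) : Prop :=
  Tendsto (heightProportion P) atTop (𝓝 δ)

/-! ### API -/

/-- Membership in `heightFamilyBelow X`: the box condition is redundant, since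
`naiveHeight (A, B) < X` forces `|A|, |B| ≤ X` (Bhargava–Shankar 2015 §1). [cite: BhargavaShankar2015, §1] -/
theorem mem_heightFamilyBelow_iff (AB : ℤ × ℤ) (X : ℕ) :
    AB ∈ heightFamilyBelow X ↔ IsInHeightFamily AB ∧ naiveHeight AB < X := by
  simp only [heightFamilyBelow, Finset.mem_filter, Finset.mem_product, Finset.mem_Icc,
    and_iff_right_iff_imp, and_imp]
  intro _ hH
  have hA : 4 * |AB.1| ^ 3 < X := lt_of_le_of_lt (le_max_left _ _) hH
  have hB : 27 * AB.2 ^ 2 < X := lt_of_le_of_lt (le_max_right _ _) hH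
  have h1 : |AB.1| ≤ X := by nlinarith [abs_nonneg AB.1, sq_nonneg (|AB.1| - 1)]
  have h2 : |AB.2| ≤ X := by nlinarith [abs_nonneg AB.2, sq_abs AB.2, sq_nonneg (|AB.2| - 1)]
  exact ⟨abs_le.mp h1, abs_le.mp h2⟩

/-- `heightFamilyBelow` is monotone in the height bound (Bhargava–Shankar 2015 §1). [cite: BhargavaShankar2015, §1] -/
theorem heightFamilyBelow_mono : Monotone heightFamilyBelow := by
  intro X Y hXY AB
  simp only [mem_heightFamilyBelow_iff]
  rintro ⟨h, hlt⟩
  exact ⟨h, lt_of_lt_of_le hlt (by exact_mod_cast hXY)⟩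

/-- For `(A, B)` in the family, `E_{A,B}` is an elliptic curve: its discriminant is
`Δ = -16 (4A³ + 27B²) ≠ 0` (Silverman, AEC III.1; Bhargava–Shankar 2015 §1). [cite: BhargavaShankar2015, §1] -/
theorem isElliptic_shortWeierstrass {AB : ℤ × ℤ} (h : IsInHeightFamily AB) :
    (shortWeierstrass AB).IsElliptic := by
  refine ⟨Ne.isUnit ?_⟩
  have hΔ : (shortWeierstrass AB).Δ = -16 * (4 * (AB.1 : ℚ) ^ 3 + 27 * (AB.2 : ℚ) ^ 2) := by
    simp only [shortWeierstrass, WeierstrassCurve.Δ, WeierstrassCurve.b₂, WeierstrassCurve.b₄,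
      WeierstrassCurve.b₆, WeierstrassCurve.b₈]
    ring
  rw [hΔ]
  have : (4 * (AB.1 : ℚ) ^ 3 + 27 * (AB.2 : ℚ) ^ 2) ≠ 0 := by exact_mod_cast h.1
  exact mul_ne_zero (by norm_num) this

/-- A proportion is nonnegative (elementary). [folklore] -/
theorem heightProportion_nonneg (P : ℤ × ℤ → Prop) (X : ℕ) : 0 ≤ heightProportion P X := by
  unfold heightProportion heightAverage
  exact div_nonneg (Finset.sum_nonneg fun _ _ ↦ by split_ifs <;> norm_num) (Nat.cast_nonneg _)

/-- A proportion is at most `1` (elementary; uses the junk value `0 / 0 = 0` for small `X`). [folklore] -/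
theorem heightProportion_le_one (P : ℤ × ℤ → Prop) (X : ℕ) : heightProportion P X ≤ 1 := by
  unfold heightProportion heightAverage
  refine div_le_one_of_le₀ ?_ (Nat.cast_nonneg _)
  calc (∑ AB ∈ heightFamilyBelow X, if P AB then (1 : ℝ) else 0)
      ≤ ∑ AB ∈ heightFamilyBelow X, (1 : ℝ) :=
        Finset.sum_le_sum fun _ _ ↦ by split_ifs <;> norm_num
    _ = (heightFamilyBelow X).card := by simp

/-- If the proportion of curves satisfying `P` tends to `δ`, then in particular at least a
proportion `δ` satisfy `P` (elementary). [folklore] -/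
theorem HasHeightDensity.heightDensityGE {P : ℤ × ℤ → Prop} {δ : ℝ}
    (h : HasHeightDensity P δ) : HeightDensityGE P δ := by
  intro ε hε
  have := (h.eventually (Ioi_mem_nhds (sub_lt_self δ hε)))
  exact this.mono fun _ hX ↦ le_of_lt hX

/-- Every elliptic curve over `ℚ` is `ℚ`-isomorphic (via a Weierstrass change of variables) to
`E_{A,B}` for a unique pair `(A, B)` in the height family: complete the square and cube to reach
a short model, clear denominators by `u = d⁻¹`, and remove `p⁴ ∣ A, p⁶ ∣ B` by `u = p`
(Silverman, AEC III.1 and Cor. III.1.5 with `j`-invariant bookkeeping; Bhargava–Shankar,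
Ann. of Math. 181 (2015) §1). [cite: BhargavaShankarAnnals2015, §1 (every E/ℚ has a unique model E_{A,B} with p⁴∤A or p⁶∤B); Silverman AEC III.1] -/
def exists_unique_isInHeightFamily_variableChange : Prop :=
  ∀ (W : WeierstrassCurve ℚ) [W.IsElliptic],
    ∃! AB : ℤ × ℤ, IsInHeightFamily AB ∧
      ∃ C : WeierstrassCurve.VariableChange ℚ, C • W = shortWeierstrass AB

end Literature.NumberTheory.EllipticCurves
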